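import Summits.HodgeConjecture.HodgeConjecture.Theorems.F0P5TP2StubT
import Summits.HodgeConjecture.HodgeConjecture.Theorems.F0P5TP2StubH2ProjectedL2Data
import Summits.HodgeConjecture.HodgeConjecture.Theorems.F0P5TP2StubG
import Summits.HodgeConjecture.HodgeConjecture.Theorems.F0P5TP2StubS
import Summits.HodgeConjecture.HodgeConjecture.Theorems.F0P5TP2StubR2
import Literature.NumberTheory.Automorphic.UnitaryCurveConeReproducingKernel
import Literature.NumberTheory.Automorphic.UnitaryCurveCotangentSpectralProjection
import HarnessLib

/-!
# Crux `HLiu418` — K-LANE SUB-LINE F0-P5TP2SpectralProjection, ASSEMBLY: TP₂ AT HERMITIAN `σ_ι H`, unconditionally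

HC_CM is proved only modulo the printed citations until rung 0 closes.  Cell `hodgecm-mathlib`, floor 0, programme P5.  The named fact
TP₂ = ★ `UnitaryCurveForms.holCotFormSpectralProjection₂` («the spectral projection `pr_P` of a square-integrable cone-holomorphic cotangent
form of the unitary Shimura CURVE is the class of a cone-holomorphic cotangent form») was cut by the sub-line skeleton
`Cruxes/HLiu418/Lines/F0_P5TP2SpectralProjection.lean` (A-p14 (g16)) into the stubs (N₂)(K₂)(S₂)(H₂)(R₂)(G₂)(T₂); the six analytic ones are ★:
(K₂) `UnitaryCurveForms.exists_coneReproducingKernel_probe` (F0P5-p01 (g2)), (S₂) `F0P5TP2StubS.stubS₂_holds` (F0P2-p02 (g2); second proof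
`F0P5TP2StubS2.stubS₂_holds`), (H₂) `F0P5TP2StubH2ProjectedL2Data.stubH₂_holds` (A-p02 (g18)), (R₂) `F0P5TP2StubR2.stubR₂_holds` (A-p04 (g21)),
(G₂) `F0P5TP2StubG.stubG₂_holds` (A-p04 (g21)), (T₂) `F0P5TP2StubT.stubT₂_holds` (A-p14 (g16)).  This file runs the skeleton's head
`holCotFormSpectralProjection₂Herm_of` on them, with every Lines-local bundle unfolded, and proves UNCONDITIONALLY

  `holCotFormSpectralProjection₂Herm_holds` — the body of ★ `holCotFormSpectralProjection₂` with ONE extra binder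
  `(H.map (cmPlace L ι).1.embedding).IsHermitian →` after the congruence hypothesis `hg`,

i.e. EXACTLY the letter of TP₂ after the desk's R1 edition (α-lite) ∕ road (i′) (F0P5-plan (g0) 02:17:57Z ∕ 02:30:56Z, F0P5-ref1 clearance
02:34:06Z): once that in-place edition lands, `holCotFormSpectralProjection₂_holds := holCotFormSpectralProjection₂Herm_holds` closes TP₂.
(Why the binder: the letter quantifies over all `t ≠ 0`, and `σ_ι H = ι(t)⁻¹ σ_ι(tH)` is hermitian only for `ι t ∈ ℝ`; every ★ consumer holds it.)
THEOREMS ONLY; no definition, no instance, no `sorry`.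

PROOF (plumbing, [Borel1997, Thm. 2.13 and §5.14]; [BorelJacquet1979, §4.6]): the frame's `𝔭`-probe `X` and its family `γ z = exp (X z)` (★
`UnitaryCurveCone.exists_coneProbe` ∕ `exists_expFamily_archLocal`), a Haar measure `ν` on `U(σ_ι H)(ℂ)` and the reproducing kernel `A` of (K₂);
(S₂) gives the `L²`-level cotangent data of `[f]`, (H₂) transports it to `w := pr_P [f]`, (R₂) realises `w` by a regular `Ψ`, (G₂) gives pointwise
Cauchy–Riemann of `Ψ` from the weak one, (T₂) puts `Ψ` in `holCotForms₂ 𝔣`; `f' := Ψ`.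

## References
* [Borel1997] A. Borel, *Automorphic forms on SL₂(ℝ)*, Cambridge Tracts in Math. 130 (1997), Thm. 2.13, §5.14, §8.4.
* [BorelJacquet1979] A. Borel, H. Jacquet, *Automorphic forms and automorphic representations*, PSPM 33.1 (1979), §4.2, §4.6.
* [BorelWallach2000] A. Borel, N. Wallach, *Continuous cohomology, discrete subgroups, and representations…*, 2nd ed., VII 2.10, XIII 1.2.
-/

set_option autoImplicit false
set_option linter.dupNamespace false -- the mandated namespace repeats `HodgeConjecture.HodgeConjecture`

noncomputable section

namespace Summit.HodgeConjecture.HodgeConjecture.Cruxes.HLiu418.F0P5TP2HermAssembly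

open scoped Matrix ComplexOrder Matrix.Norms.Operator
open NumberField NumberField.InfinitePlace MeasureTheory
open Literature.NumberTheory.Automorphic Literature.NumberTheory.Automorphic.UnitaryGroup
open Literature.NumberTheory.Automorphic.UnitaryCurveForms
open Literature.NumberTheory.Automorphic.UnitaryGroup.CotangentForms (toQuotFun)
open Literature.AlgebraicGeometry.ShimuraVarieties

/-- **TP₂ AT HERMITIAN `σ_ι H`, UNCONDITIONALLY** — the body of ★ `UnitaryCurveForms.holCotFormSpectralProjection₂` with the single extra
binder `(H.map (cmPlace L ι).1.embedding).IsHermitian →` after `hg` (= the letter after the R1 (α-lite) edition, token for token): for the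
rank-2 CM engine (`t • H ≃ diag dV` over `L`, signature `(1,1)` at `ι`, definite at the places `≠ ι`, `[L:ℚ] ≥ 4`), a cone frame `𝔣`, an
automorphic `μ`, a discrete `P` and `f ∈ holCotForms₂ 𝔣` with square-integrable descent, `pr_P [f] = [f′]` for some square-integrable
`f′ ∈ holCotForms₂ 𝔣`. [cite: Borel1997, Thm. 2.13 and §5.14] [cite: BorelJacquet1979, §4.6] [cite: BorelWallach2000, VII 2.10] -/
theorem holCotFormSpectralProjection₂Herm_holds :
    ∀ (L : Type) [Field L] [NumberField L] [IsCMField L] (ι : L →+* ℂ) (H : Matrix (Fin 2) (Fin 2) L)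
    (dV : Fin 2 → L) (_hdV : ∀ i, IsCMField.complexConj L (dV i) = dV i) (_hdV0 : ∀ i, dV i ≠ 0)
    (t : L) (_ht : t ≠ 0) (g : GL (Fin 2) L),
    formCongr ((IsCMField.complexConj L : L ≃ₐ[↥(maximalRealSubfield L)] L) : L →+* L) g (t • H) = Matrix.diagonal dV →
    (H.map (cmPlace L ι).1.embedding).IsHermitian →
    (∃ T : GL (Fin 2) ℂ, formCongr (starRingEnd ℂ) T ((Matrix.diagonal dV).map ι) = Matrix.diagonal ![(1 : ℂ), -1]) →
    (∀ τ' : L →+* ℂ, InfinitePlace.mk τ' ≠ InfinitePlace.mk ι → ((Matrix.diagonal dV).map τ').PosDef) →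
    4 ≤ Module.finrank ℚ L →
    ∀ (𝔣 : ConeFrame L H (cmPlace L ι))
      (μ : Measure (adelicGroupData (↥(maximalRealSubfield L)) L (IsCMField.complexConj L) 2 H).automorphicQuotient)
      [(adelicGroupData (↥(maximalRealSubfield L)) L (IsCMField.complexConj L) 2 H).IsAutomorphicMeasure μ]
      (P : DiscreteAutomorphicRep (adelicGroupData (↥(maximalRealSubfield L)) L (IsCMField.complexConj L) 2 H) μ)
      (f : (adelicGroupData (↥(maximalRealSubfield L)) L (IsCMField.complexConj L) 2 H).Adelic → ℂ),
      f ∈ holCotForms₂ (↥(maximalRealSubfield L)) L (IsCMField.complexConj L) H (IsCMField.complexConj_ne_one L)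
          (UnitaryGroup.complexConj_smul_infinitePlace L) (cmPlace L ι) 𝔣 →
    ∀ hf : MemLp (toQuotFun (adelicGroupData (↥(maximalRealSubfield L)) L (IsCMField.complexConj L) 2 H) f) 2 μ,
      ∃ f' ∈ holCotForms₂ (↥(maximalRealSubfield L)) L (IsCMField.complexConj L) H (IsCMField.complexConj_ne_one L)
          (UnitaryGroup.complexConj_smul_infinitePlace L) (cmPlace L ι) 𝔣,
        ∃ hf' : MemLp (toQuotFun (adelicGroupData (↥(maximalRealSubfield L)) L (IsCMField.complexConj L) 2 H) f') 2 μ,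
          P.space.toSubmodule.starProjection
              (MemLp.toLp (toQuotFun (adelicGroupData (↥(maximalRealSubfield L)) L (IsCMField.complexConj L) 2 H) f) hf) =
            MemLp.toLp (toQuotFun (adelicGroupData (↥(maximalRealSubfield L)) L (IsCMField.complexConj L) 2 H) f') hf' := by
  intro L _ _ _ ι H dV hdV hdV0 t ht g hdiag hJ hsig hdef h4 𝔣 μ _ P f hfmem hf
  -- the probe and its one-parameter family
  obtain ⟨X, hXu, hXv, hXt⟩ := UnitaryCurveCone.exists_coneProbe 𝔣 hJ
  obtain ⟨γ, hγ⟩ := UnitaryCurveCone.exists_expFamily_archLocal 𝔣 hJ X hXu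
  -- a Borel structure and a Haar measure on `U(σ_ι H)(ℂ)`
  letI : MeasurableSpace (archLocal L 2 H (cmPlace L ι)) := borel _
  haveI : BorelSpace (archLocal L 2 H (cmPlace L ι)) := ⟨rfl⟩
  haveI : LocallyCompactSpace (Matrix (Fin 2) (Fin 2) ℂ) := inferInstanceAs (LocallyCompactSpace (Fin 2 → Fin 2 → ℂ))
  haveI : LocallyCompactSpace (GL (Fin 2) ℂ) := (Units.isOpenEmbedding_val (R := Matrix (Fin 2) (Fin 2) ℂ)).locallyCompactSpace
  haveI : LocallyCompactSpace (archLocal L 2 H (cmPlace L ι)) :=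
    (isClosed_archLocal L 2 H (cmPlace L ι)).isClosedEmbedding_subtypeVal.locallyCompactSpace
  set ν : Measure (archLocal L 2 H (cmPlace L ι)) := Measure.haar with hν
  -- (K₂) the reproducing kernel
  obtain ⟨A, ⟨hAc, hAs, hAd, hAcd⟩, hrepI⟩ :=
    UnitaryCurveForms.exists_coneReproducingKernel_probe 𝔣 (UnitaryCurveCone.form_v₀_t₀ 𝔣 hJ) X γ hγ ν
  have hrep : ∀ Φ : Matrix (Fin 2) (Fin 2) ℂ → ℂ, IsConeHol 𝔣 Φ →
      ∫ u, A u * Φ ((u : GL (Fin 2) ℂ) : Matrix (Fin 2) (Fin 2) ℂ) ∂ν = Φ 1 := fun Φ hΦ => (hrepI Φ hΦ).2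
  -- (S₂) the `L²`-level cotangent data of `[f]`; (H₂) of `w := pr_P [f]`
  have hu := F0P5TP2StubS.stubS₂_holds L ι H dV hdV hdV0 t ht g hdiag hJ hsig hdef h4 𝔣 X hXu hXv hXt γ hγ μ ν A hAc hAs hAd hAcd
    hrep f hfmem hf
  have hw := F0P5TP2StubH2ProjectedL2Data.stubH₂_holds L ι H 𝔣 γ μ ν A P _ hu.1 hu.2.1 hu.2.2.1 hu.2.2.2.1 hu.2.2.2.2.1
    hu.2.2.2.2.2
  -- (R₂) a regular representative `Ψ` of `w`
  obtain ⟨Ψ, hΨ⟩ := F0P5TP2StubR2.stubR₂_holds L ι H dV hdV hdV0 t ht g hdiag hJ hsig hdef h4 𝔣 X hXu γ hγ μ ν A hAc hAs hAd hAcd _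
    hw.1 hw.2.1 hw.2.2.1
  -- (G₂) pointwise Cauchy–Riemann of `Ψ`; (T₂) `Ψ ∈ holCotForms₂ 𝔣`
  have hCR := F0P5TP2StubG.stubG₂_holds (adelicGroupData (↥(maximalRealSubfield L)) L (IsCMField.complexConj L) 2 H) μ
    (adelicSingle (↥(maximalRealSubfield L)) L (IsCMField.complexConj L) 2 H (IsCMField.complexConj_ne_one L)
      (UnitaryGroup.complexConj_smul_infinitePlace L) (cmPlace L ι)) γ _ Ψ
    hΨ.1 hΨ.2.1 hΨ.2.2.1 hΨ.2.2.2.1 hΨ.2.2.2.2.1 hΨ.2.2.2.2.2 hw.2.2.2.2.2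
  have hmem := F0P5TP2StubT.stubT₂_holds L ι H hJ 𝔣 X hXu hXv hXt γ hγ μ _ Ψ hΨ hw.2.1 hw.2.2.1 hw.2.2.2.1 hCR
  have hmemLp : MemLp (toQuotFun (adelicGroupData (↥(maximalRealSubfield L)) L (IsCMField.complexConj L) 2 H) Ψ) 2 μ :=
    (Lp.memLp _).ae_eq hΨ.2.2.1.symm
  refine ⟨Ψ, hmem, hmemLp, ?_⟩
  refine (Lp.ext ?_).symm
  exact (MemLp.coeFn_toLp hmemLp).trans hΨ.2.2.1

end Summit.HodgeConjecture.HodgeConjecture.Cruxes.HLiu418.F0P5TP2HermAssembly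

end
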